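import Summits.QuantumAdvantage.QuantumAdvantage.Theorems.CubicForrelationNearExactIsExactTwelveLevelSixH34Rigid

/-!
# Crux `CubicForrelation.NearExactIsExact` (stmt-QuantumAdvantage-14043) — n = 12, level ≥ 6 below `936/1024`: (H3)/(H4) for the RIGID sparse
  configurations with up to `63` exceptional points (gen 18's `tw18_H34_rigid` had `≤ 48`, the count at `Σ e² = 704`)

Certificate seat `b2b-cforr-cert` (gen 18).  HONEST FRAMING: a lemma (standard axioms) for the level-`≥ 6` branch of the `n = 12` window analysis
at budgets `Σ e² ≤ 712 … 760` (off-flat energies up to `248`, i.e. up to `62` points with `e = ±2`); finite-slice bookkeeping, NOT summit progress.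
The proof is `tw18_H34_rigid` verbatim: the few-hit lemma `tw18_dirs_few_hits` gives `512·hits ≤ 2^k·#Ω`, and `#Ω ≤ 63` still means NO hit for an
inner 3-flat (`504 < 512`) and AT MOST ONE for an inner 4-flat (`1008 < 1024`).
References: J. Ax (1964) / R. J. McEliece (1972); MacWilliams–Sloane (1977) Ch. 13 §3.  Axioms: the standard three.
-/

set_option linter.dupNamespace false -- D-0017: single-problem summit ⇒ `QuantumAdvantage.QuantumAdvantage` by design

noncomputable section

namespace Summit.QuantumAdvantage.QuantumAdvantage.Theorems.CubicForrelation.NearExactIsExact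

open Finset
open Literature.Computability.QuantumComplexity
open Literature.Computability.QuantumComplexity.BuzetChailloux (bxor zeroVec bxor_bxor_cancel_left bxor_zeroVec zeroVec_bxor bxor_comm
  bxor_self)
open Literature.Computability.QuantumComplexity.DerivativeWalsh (W)

/-! ### (H3)/(H4) for the rigid configurations, up to `63` exceptional points -/

/-- **(H3) and (H4) on the 9-flat, rigid version.**  Cubic `f, g`, `W_g = 64u''`, `Z = {u'' even} = x_Z ⊕ V₀`, `e = u'' − (−1)^f`; three
cosets `yᵢ ⊕ V₀` (`yᵢ ∉ Z`, pairwise distinct) and a set `Ω` inside them with `#Ω ≤ 63`, such that off `Z` every point with `8 ∤ e` lies in `Ω`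
and `e² = 4` on `Ω`.  Then every parametrised 3-flat sum of `e` inside `Z` is `≡ 0 (mod 4)` and every 4-flat sum is `≡ 0 (mod 8)`. [this work; `tw18_H34_rigid` verbatim with `48 → 63`: `8·63 < 512`, `16·63 < 1024`] -/
theorem tw18_H34_rigid63 (f g : (Fin (6 + 6) → Bool) → Bool) (hf : IsDegLeFun 3 f) (hg : IsDegLeFun 3 g)
    (u'' : (Fin (6 + 6) → Bool) → ℤ) (hu'' : ∀ x, W (fun y => signOf (g y)) x = (2 : ℝ) ^ 6 * (u'' x : ℝ))
    (V₀ : Finset (Fin (6 + 6) → Bool)) (xZ : Fin (6 + 6) → Bool) (h0 : zeroVec ∈ V₀)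
    (hadd : ∀ a ∈ V₀, ∀ b ∈ V₀, bxor a b ∈ V₀) (hcardV : #V₀ = 512)
    (hS : (univ.filter fun x : Fin (6 + 6) → Bool => ¬ Odd (u'' x)) = V₀.image (bxor xZ))
    (Ω : Finset (Fin (6 + 6) → Bool)) (y₁ y₂ y₃ : Fin (6 + 6) → Bool)
    (hy₁ : y₁ ∉ (univ.filter fun x : Fin (6 + 6) → Bool => ¬ Odd (u'' x)))
    (hy₂ : y₂ ∉ (univ.filter fun x : Fin (6 + 6) → Bool => ¬ Odd (u'' x)))
    (hy₃ : y₃ ∉ (univ.filter fun x : Fin (6 + 6) → Bool => ¬ Odd (u'' x)))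
    (hy₁₂ : y₂ ∉ V₀.image (bxor y₁)) (hy₁₃ : y₃ ∉ V₀.image (bxor y₁)) (hy₂₃ : y₃ ∉ V₀.image (bxor y₂))
    (hΩC : ∀ ω ∈ Ω, ω ∈ V₀.image (bxor y₁) ∨ ω ∈ V₀.image (bxor y₂) ∨ ω ∈ V₀.image (bxor y₃)) (hΩ63 : #Ω ≤ 63)
    (hΩbad : ∀ y, y ∉ (univ.filter fun x : Fin (6 + 6) → Bool => ¬ Odd (u'' x)) → ¬ (8 : ℤ) ∣ u'' y - sZ (f y) → y ∈ Ω)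
    (hΩsq : ∀ y ∈ Ω, (u'' y - sZ (f y)) ^ 2 = 4) :
    (∀ x ∈ (univ.filter fun x : Fin (6 + 6) → Bool => ¬ Odd (u'' x)), ∀ a b c : Fin (6 + 6) → Bool,
      a ∈ V₀ → b ∈ V₀ → c ∈ V₀ →
      (4 : ℤ) ∣ ∑ ε : Fin 3 → Bool, (u'' (fun j => x j ^^ decide (Odd #(univ.filter fun i =>
        ε i && (![a, b, c] : Fin 3 → Fin (6 + 6) → Bool) i j))) - sZ (f (fun j => x j ^^ decide (Odd #(univ.filter fun i =>
        ε i && (![a, b, c] : Fin 3 → Fin (6 + 6) → Bool) i j)))))) ∧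
    (∀ x ∈ (univ.filter fun x : Fin (6 + 6) → Bool => ¬ Odd (u'' x)), ∀ a₀ a₁ a₂ a₃ : Fin (6 + 6) → Bool,
      a₀ ∈ V₀ → a₁ ∈ V₀ → a₂ ∈ V₀ → a₃ ∈ V₀ →
      (8 : ℤ) ∣ ∑ ε : Fin 4 → Bool, (u'' (fun j => x j ^^ decide (Odd #(univ.filter fun i =>
        ε i && (![a₀, a₁, a₂, a₃] : Fin 4 → Fin (6 + 6) → Bool) i j))) - sZ (f (fun j => x j ^^ decide (Odd #(univ.filter fun i =>
        ε i && (![a₀, a₁, a₂, a₃] : Fin 4 → Fin (6 + 6) → Bool) i j)))))) := by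
  classical
  set Z := univ.filter (fun x : Fin (6 + 6) → Bool => ¬ Odd (u'' x)) with hZdef
  set e : (Fin (6 + 6) → Bool) → ℤ := fun x => u'' x - sZ (f x) with hedef
  show (∀ x ∈ Z, ∀ a b c : Fin (6 + 6) → Bool, a ∈ V₀ → b ∈ V₀ → c ∈ V₀ →
      (4 : ℤ) ∣ ∑ ε : Fin 3 → Bool, e (fun j => x j ^^ decide (Odd #(univ.filter fun i =>
        ε i && (![a, b, c] : Fin 3 → Fin (6 + 6) → Bool) i j)))) ∧
    (∀ x ∈ Z, ∀ a₀ a₁ a₂ a₃ : Fin (6 + 6) → Bool, a₀ ∈ V₀ → a₁ ∈ V₀ → a₂ ∈ V₀ → a₃ ∈ V₀ →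
      (8 : ℤ) ∣ ∑ ε : Fin 4 → Bool, e (fun j => x j ^^ decide (Odd #(univ.filter fun i =>
        ε i && (![a₀, a₁, a₂, a₃] : Fin 4 → Fin (6 + 6) → Bool) i j))))
  change ∀ y, y ∉ Z → ¬ (8 : ℤ) ∣ e y → y ∈ Ω at hΩbad
  change ∀ y ∈ Ω, e y ^ 2 = 4 at hΩsq
  have hPV : ∀ x, x ∈ Z → ∀ a ∈ V₀, bxor x a ∈ Z := fun x hx a ha => fl1_coset_vadd hadd hS hx ha
  have hΩval : ∀ y ∈ Ω, e y = 2 ∨ e y = -2 := by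
    intro y hy
    have h := hΩsq y hy
    have h' : (e y - 2) * (e y + 2) = 0 := by ring_nf; linarith
    rcases mul_eq_zero.1 h' with h1 | h1
    · left; linarith
    · right; linarith
  -- the localisation: flat sum = inner sum + (seven translated sums ≡ R mod 8, |R| ≤ 2·hits, R even)
  have hloc : ∀ {k : ℕ} (x : Fin (6 + 6) → Bool), x ∈ Z → ∀ (a : Fin k → Fin (6 + 6) → Bool), (∀ i, a i ∈ V₀) →
      ∃ (t₁ t₂ t₃ : Fin (6 + 6) → Bool) (R : ℤ) (N : ℕ),
      (8 : ℤ) ∣ (∑ ε : Fin (k + 3) → Bool, e (fun j => x j ^^ decide (Odd #(univ.filter fun i =>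
          ε i && (Matrix.vecCons t₁ (Matrix.vecCons t₂ (Matrix.vecCons t₃ a)) : Fin (k + 3) → Fin (6 + 6) → Bool) i j)))) -
        (∑ ε : Fin k → Bool, e (fun j => x j ^^ decide (Odd #(univ.filter fun i => ε i && a i j)))) - R ∧
      |R| ≤ 2 * N ∧ Even R ∧ 512 * N ≤ 2 ^ k * 63 := by
    intro k x hx a ha
    obtain ⟨t₁, t₂, t₃, hoff, hcnt⟩ := tw18_dirs_few_hits V₀ Z Ω xZ y₁ y₂ y₃ h0 hadd hcardV hS hy₁ hy₂ hy₃ hy₁₂ hy₁₃ hy₂₃ hΩC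
      x hx a ha
    set pt : (Fin k → Bool) → (Fin (6 + 6) → Bool) := fun ε => fun j => x j ^^ decide (Odd #(univ.filter fun i => ε i && a i j))
      with hpt
    obtain ⟨d1, b1, v1⟩ := tw18_family_mod8 e Z Ω hΩbad hΩval (fun ε => bxor (pt ε) t₁) fun ε => (hoff ε).1
    obtain ⟨d2, b2, v2⟩ := tw18_family_mod8 e Z Ω hΩbad hΩval (fun ε => bxor (pt ε) t₂) fun ε => (hoff ε).2.1
    obtain ⟨d3, b3, v3⟩ := tw18_family_mod8 e Z Ω hΩbad hΩval (fun ε => bxor (bxor (pt ε) t₂) t₁) fun ε => (hoff ε).2.2.1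
    obtain ⟨d4, b4, v4⟩ := tw18_family_mod8 e Z Ω hΩbad hΩval (fun ε => bxor (pt ε) t₃) fun ε => (hoff ε).2.2.2.1
    obtain ⟨d5, b5, v5⟩ := tw18_family_mod8 e Z Ω hΩbad hΩval (fun ε => bxor (bxor (pt ε) t₃) t₁) fun ε => (hoff ε).2.2.2.2.1
    obtain ⟨d6, b6, v6⟩ := tw18_family_mod8 e Z Ω hΩbad hΩval (fun ε => bxor (bxor (pt ε) t₃) t₂) fun ε => (hoff ε).2.2.2.2.2.1
    obtain ⟨d7, b7, v7⟩ := tw18_family_mod8 e Z Ω hΩbad hΩval (fun ε => bxor (bxor (bxor (pt ε) t₃) t₂) t₁)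
      fun ε => (hoff ε).2.2.2.2.2.2
    refine ⟨t₁, t₂, t₃,
      (∑ ε : Fin k → Bool, (if bxor (pt ε) t₁ ∈ Ω then e (bxor (pt ε) t₁) else 0)) +
      (∑ ε : Fin k → Bool, (if bxor (pt ε) t₂ ∈ Ω then e (bxor (pt ε) t₂) else 0)) +
      (∑ ε : Fin k → Bool, (if bxor (bxor (pt ε) t₂) t₁ ∈ Ω then e (bxor (bxor (pt ε) t₂) t₁) else 0)) +
      (∑ ε : Fin k → Bool, (if bxor (pt ε) t₃ ∈ Ω then e (bxor (pt ε) t₃) else 0)) +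
      (∑ ε : Fin k → Bool, (if bxor (bxor (pt ε) t₃) t₁ ∈ Ω then e (bxor (bxor (pt ε) t₃) t₁) else 0)) +
      (∑ ε : Fin k → Bool, (if bxor (bxor (pt ε) t₃) t₂ ∈ Ω then e (bxor (bxor (pt ε) t₃) t₂) else 0)) +
      (∑ ε : Fin k → Bool, (if bxor (bxor (bxor (pt ε) t₃) t₂) t₁ ∈ Ω then e (bxor (bxor (bxor (pt ε) t₃) t₂) t₁) else 0)),
      ∑ ε : Fin k → Bool,
        ((if bxor (pt ε) t₁ ∈ Ω then 1 else 0) + (if bxor (pt ε) t₂ ∈ Ω then 1 else 0) +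
         (if bxor (bxor (pt ε) t₂) t₁ ∈ Ω then 1 else 0) + (if bxor (pt ε) t₃ ∈ Ω then 1 else 0) +
         (if bxor (bxor (pt ε) t₃) t₁ ∈ Ω then 1 else 0) + (if bxor (bxor (pt ε) t₃) t₂ ∈ Ω then 1 else 0) +
         (if bxor (bxor (bxor (pt ε) t₃) t₂) t₁ ∈ Ω then 1 else 0)),
      ?_, ?_, ?_, hcnt.trans (Nat.mul_le_mul_left _ hΩ63)⟩
    · rw [tw18_peel3 e x t₁ t₂ t₃ a]
      simp only [sum_add_distrib]
      have := dvd_add (dvd_add (dvd_add (dvd_add (dvd_add (dvd_add d1 d2) d3) d4) d5) d6) d7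
      have e7 : ∀ (A B C D E F G a b c d e' f' g' P : ℤ),
          P + (A + B + C + D + E + F + G) - P - (a + b + c + d + e' + f' + g') =
            (A - a) + (B - b) + (C - c) + (D - d) + (E - e') + (F - f') + (G - g') := fun _ _ _ _ _ _ _ _ _ _ _ _ _ _ _ => by ring
      rw [e7]
      exact this
    · push_cast
      simp only [sum_add_distrib]
      have h7abs : ∀ A B C D E F G : ℤ, |A + B + C + D + E + F + G| ≤ |A| + |B| + |C| + |D| + |E| + |F| + |G| := by
        intro A B C D E F G
        linarith [abs_add_le (A + B + C + D + E + F) G, abs_add_le (A + B + C + D + E) F, abs_add_le (A + B + C + D) E,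
          abs_add_le (A + B + C) D, abs_add_le (A + B) C, abs_add_le A B]
      refine (h7abs _ _ _ _ _ _ _).trans ?_
      linarith [b1, b2, b3, b4, b5, b6, b7]
    · exact ((((((v1.add v2).add v3).add v4).add v5).add v6).add v7)
  -- (H3): no hit at all for an inner 3-flat
  have H3 : ∀ x ∈ Z, ∀ a b c : Fin (6 + 6) → Bool, a ∈ V₀ → b ∈ V₀ → c ∈ V₀ →
      (4 : ℤ) ∣ ∑ ε : Fin 3 → Bool, e (fun j => x j ^^ decide (Odd #(univ.filter fun i =>
        ε i && (![a, b, c] : Fin 3 → Fin (6 + 6) → Bool) i j))) := by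
    intro x hx a b c ha hb hc
    obtain ⟨t₁, t₂, t₃, R, N, hdvd, hR, -, hN⟩ := hloc x hx ![a, b, c] (fun i => by fin_cases i <;> assumption)
    have hN0 : N = 0 := by norm_num at hN; omega
    have hR0 : R = 0 := by rw [hN0] at hR; simpa using hR
    have h4 : (4 : ℤ) ∣ ∑ ε : Fin (3 + 3) → Bool, e (fun j => x j ^^ decide (Odd #(univ.filter fun i =>
        ε i && (Matrix.vecCons t₁ (Matrix.vecCons t₂ (Matrix.vecCons t₃ ![a, b, c])) : Fin (3 + 3) → Fin (6 + 6) → Bool) i j))) :=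
      tw15_e_flat6 f g hf hg u'' hu'' x _
    rw [hR0, sub_zero] at hdvd
    have h4' := (show (4 : ℤ) ∣ 8 by norm_num).trans hdvd
    have := dvd_sub h4 h4'
    simpa using this
  refine ⟨H3, ?_⟩
  -- (H4): at most one hit for an inner 4-flat; the remainder `R` is `0` by (H3) on the two inner 3-flats
  intro x hx a₀ a₁ a₂ a₃ ha₀ ha₁ ha₂ ha₃
  obtain ⟨t₁, t₂, t₃, R, N, hdvd, hR, hReven, hN⟩ := hloc x hx ![a₀, a₁, a₂, a₃] (fun i => by fin_cases i <;> assumption)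
  have hN1 : N ≤ 1 := by norm_num at hN; omega
  have h8 : (8 : ℤ) ∣ ∑ ε : Fin (4 + 3) → Bool, e (fun j => x j ^^ decide (Odd #(univ.filter fun i =>
      ε i && (Matrix.vecCons t₁ (Matrix.vecCons t₂ (Matrix.vecCons t₃ ![a₀, a₁, a₂, a₃])) : Fin (4 + 3) → Fin (6 + 6) → Bool) i j))) :=
    tw15_e_flat7 f g hf hg u'' hu'' x _
  -- the inner 4-flat sum is `≡ 0 (mod 4)`: two 3-flat sums
  have h4 : (4 : ℤ) ∣ ∑ ε : Fin 4 → Bool, e (fun j => x j ^^ decide (Odd #(univ.filter fun i =>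
      ε i && (![a₀, a₁, a₂, a₃] : Fin 4 → Fin (6 + 6) → Bool) i j))) := by
    have hp := fr_sum_peel e x a₀ ![a₁, a₂, a₃]
    rw [hp]
    refine dvd_add (H3 x hx a₁ a₂ a₃ ha₁ ha₂ ha₃) ?_
    have hx' : bxor x a₀ ∈ Z := hPV x hx a₀ ha₀
    have h3' := H3 (bxor x a₀) hx' a₁ a₂ a₃ ha₁ ha₂ ha₃
    have e1 : ∀ ε : Fin 3 → Bool, bxor (fun j => x j ^^ decide (Odd #(univ.filter fun i =>
        ε i && (![a₁, a₂, a₃] : Fin 3 → Fin (6 + 6) → Bool) i j))) a₀ =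
        fun j => (bxor x a₀) j ^^ decide (Odd #(univ.filter fun i => ε i && (![a₁, a₂, a₃] : Fin 3 → Fin (6 + 6) → Bool) i j)) := by
      intro ε
      funext j
      simp only [bxor]
      cases x j <;> cases a₀ j <;> simp
    rw [sum_congr rfl fun ε _ => by rw [e1 ε]]
    exact h3'
  have hR2 : |R| ≤ 2 := by
    have : (N : ℤ) ≤ 1 := by exact_mod_cast hN1
    linarith
  obtain ⟨c, hc⟩ := hReven
  obtain ⟨q, hq⟩ := h4
  rw [hq] at hdvd ⊢
  obtain ⟨m, hm⟩ := h8
  rw [hm] at hdvd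
  obtain ⟨r, hr⟩ := hdvd
  rw [abs_le] at hR2
  have : (2 : ℤ) ∣ q := by omega
  obtain ⟨q', rfl⟩ := this
  exact ⟨q', by ring⟩

end Summit.QuantumAdvantage.QuantumAdvantage.Theorems.CubicForrelation.NearExactIsExact

end
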